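import Summits.CriticalPhenomena.PercolationContinuityZ3.Theorems.PercNearOneGluingNoHeavyPcintChordDefs
import HarnessLib

/-!
# PCINT lane: chord PAIRS of a step word and the injection pairs ↦ edges (bookkeeping for weighted automata)

Cell `prim-pcint`, seat `prim-pcint-2`; memo `run/shared/lean/prim/pcint/REDUCTIONS.md` §R2.2 (domination: an
automaton that charges `(1-p)` once per chord PAIR `(i, j)` it sees charges a sub-family of the chord edges).
Does NOT build on p205010.

For a self-avoiding word the map `(i, j) ↦ {v_i, v_j}` from chord pairs (`i + 2 ≤ j ≤ n`, `v_i ~ v_j`) to chord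
edges is injective, so every finite family of chord pairs an automaton accounts for — e.g. the pairs of span
`j - i ≤ k` visible in a memory-`k` window — has cardinality at most `(chordEdges w).card`.  This is the
combinatorial half of "automaton weight ≥ true weight" for certificate kind `chord_cw` (B3), independent of
how the automaton encodes its states.

* `chordPairs`, `mem_chordPairs`, `chordEdges_eq_image_chordPairs`;
* `IsSAW.injOn_chordPairs`, `IsSAW.card_chordPairs_eq`;
* `IsSAW.card_le_card_chordEdges_of_subset` — any sub-family of chord pairs is no larger than the chord-edge set.
-/

noncomputable section

namespace Summit.CriticalPhenomena.PercolationContinuityZ3.Theorems.Pcint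

open Literature.Probability.Percolation Literature.Probability.LatticeModels

variable {d : ℕ}

open Classical in
/-- The chord PAIRS of a word of length `n`: index pairs `(i, j)` with `i + 2 ≤ j ≤ n` whose sites are
lattice-adjacent. [folklore] -/
def chordPairs {n : ℕ} (w : Fin n → Fin d × Bool) : Finset (ℕ × ℕ) :=
  (Finset.range (n + 1) ×ˢ Finset.range (n + 1)).filter fun ij =>
    ij.1 + 2 ≤ ij.2 ∧ (zdGraph d).Adj (wordPos w ij.1) (wordPos w ij.2)

/-- Membership in `chordPairs`. [folklore] -/
theorem mem_chordPairs {n : ℕ} {w : Fin n → Fin d × Bool} {ij : ℕ × ℕ} :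
    ij ∈ chordPairs w ↔ ij.1 + 2 ≤ ij.2 ∧ ij.2 ≤ n ∧ (zdGraph d).Adj (wordPos w ij.1) (wordPos w ij.2) := by
  classical
  rw [chordPairs, Finset.mem_filter, Finset.mem_product, Finset.mem_range, Finset.mem_range]
  constructor
  · rintro ⟨⟨-, h2⟩, hij, hadj⟩; exact ⟨hij, by omega, hadj⟩
  · rintro ⟨hij, hjn, hadj⟩; exact ⟨⟨by omega, by omega⟩, hij, hadj⟩

/-- The chord edges are the image of the chord pairs under `(i, j) ↦ {v_i, v_j}`. [folklore] -/
theorem chordEdges_eq_image_chordPairs {n : ℕ} (w : Fin n → Fin d × Bool) :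
    chordEdges w = (chordPairs w).image fun ij => s(wordPos w ij.1, wordPos w ij.2) := by
  classical
  rfl

/-- For a self-avoiding word, distinct chord pairs give distinct chord edges. [folklore] -/
theorem IsSAW.injOn_chordPairs {n : ℕ} {w : Fin n → Fin d × Bool} (h : IsSAW w) :
    Set.InjOn (fun ij : ℕ × ℕ => s(wordPos w ij.1, wordPos w ij.2)) ↑(chordPairs w) := by
  intro ij hij kl hkl heq
  obtain ⟨hij1, hij2, -⟩ := mem_chordPairs.1 (Finset.mem_coe.1 hij)
  obtain ⟨hkl1, hkl2, -⟩ := mem_chordPairs.1 (Finset.mem_coe.1 hkl)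
  have heq' : s(wordPos w ij.1, wordPos w ij.2) = s(wordPos w kl.1, wordPos w kl.2) := heq
  rw [Sym2.eq_iff] at heq'
  rcases heq' with ⟨h1, h2⟩ | ⟨h1, h2⟩
  · exact Prod.ext (h _ _ (by omega) (by omega) h1) (h _ _ (by omega) (by omega) h2)
  · have e1 := h _ _ (by omega) (by omega) h1
    have e2 := h _ _ (by omega) (by omega) h2
    omega

/-- For a self-avoiding word, `#chordPairs = #chordEdges`. [folklore] -/
theorem IsSAW.card_chordPairs_eq {n : ℕ} {w : Fin n → Fin d × Bool} (h : IsSAW w) :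
    (chordPairs w).card = (chordEdges w).card := by
  classical
  rw [chordEdges_eq_image_chordPairs, Finset.card_image_of_injOn (IsSAW.injOn_chordPairs h)]

/-- **Bookkeeping for weighted automata**: for a self-avoiding word, any family `P` of chord pairs (for
instance the pairs of span `≤ k` that a memory-`k` automaton charges, each once) has
`P.card ≤ (chordEdges w).card`; hence `(1-p)^{P.card} ≥ (1-p)^{#chordEdges w}`. [folklore] -/
theorem IsSAW.card_le_card_chordEdges_of_subset {n : ℕ} {w : Fin n → Fin d × Bool} (h : IsSAW w)
    {P : Finset (ℕ × ℕ)} (hP : P ⊆ chordPairs w) : P.card ≤ (chordEdges w).card := by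
  rw [← IsSAW.card_chordPairs_eq h]
  exact Finset.card_le_card hP

/-- The corresponding weight inequality: charging `(1-p)` per pair of a sub-family over-estimates the true
chord weight `(1-p)^{#chordEdges w}` (`0 ≤ 1 - p ≤ 1`). [folklore] -/
theorem IsSAW.chordWeight_le_pow_card {n : ℕ} {w : Fin n → Fin d × Bool} (h : IsSAW w)
    {P : Finset (ℕ × ℕ)} (hP : P ⊆ chordPairs w) {q : ℝ} (hq0 : 0 ≤ q) (hq1 : q ≤ 1) :
    q ^ (chordEdges w).card ≤ q ^ P.card :=
  pow_le_pow_of_le_one hq0 hq1 (IsSAW.card_le_card_chordEdges_of_subset h hP)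

end Summit.CriticalPhenomena.PercolationContinuityZ3.Theorems.Pcint
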